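import Mathlib
import Summits.Ventures.Crystal3D.Theorems.StickyWulffConstantTextureLiminfTentHatAffine
import Summits.Ventures.Crystal3D.Theorems.StickyWulffConstantTextureLiminfTentTablesBridge
import Literature.MathematicalPhysics.StatisticalMechanics.BarlowStacking
import HarnessLib

/-!
# The tent certificate — the cubic coefficient frame IS the Barlow reference fcc frame (eng g9)

Route `StickyWulffConstant` (`Summits/Ventures/Crystal3D`, cell `crystal3d-full`), support toward the crux
`TextureLiminf` (stmt-Ventures-19483), line TexShadow v6.2, stub `stub_barlowFreeCertificate`: step (2′)
of HOME/eng/MEMO-9 §F — the global linear isometry `toRef` carrying the cubic coefficient model of the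
tent files (`site n = (√2)⁻¹ • (n₀+n₁, n₀+n₂, n₁+n₂)`) onto the Barlow reference lattice
`fccStacking 1 √(2/3)` of `Literature/…/BarlowStacking.lean`, layer by layer:
`toRef (site n) = barlowPos 1 √(2/3) constHagg (n₀+n₁+n₂) (−n₁) (−n₂)`, so the `(111)` layer index
`n₀+n₁+n₂` of the tent files becomes the Barlow layer index and the height functional is
`(toRef x)₃ = (h/2)·⟪(1,1,1), √2 x⟫` (open bilayer slab `{2i < ⟪(1,1,1), √2 x⟫ < 2i+2}` ↦
`{i h < r₃ < (i+1) h}`).  Construction: the frames `site e₀, site e₁, site e₂` and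
`w + h e₃, w + h e₃ − u, w + h e₃ − v` have the same Gram matrix (`1` / `½`), so "match the bases" is an
isometry (as in `Literature/…/FlatleyTheil2015FccLatticeLayers.lean`).
WHAT THIS IS NOT: the transport of the certificate itself; F-C1 not moved.
-/

noncomputable section

namespace Summit.Ventures.Crystal3D.TentCertificate

open Finset Summit.Ventures.Crystal3D MeasureTheory
open Literature.Geometry.DiscreteGeometry (intVec intVec_apply)
open Literature.MathematicalPhysics.StatisticalMechanics (fccStacking barlowStacking barlowPos barlowLayer
  constHagg triangularVec₁ triangularVec₂ barlowOffset layerNormal haggLabel_const mem_barlowStacking_iff)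
open scoped RealInnerProductSpace

/-- The ideal layer spacing `h = √(2/3)` of the Barlow reference frame (nearest-neighbour distance `1`). -/
abbrev hB : ℝ := Real.sqrt (2 / 3)

/-- `h² = 2/3`. -/
theorem hB_sq : hB ^ 2 = 2 / 3 := Real.sq_sqrt (by norm_num)

/-- `0 < h`. -/
theorem hB_pos : 0 < hB := Real.sqrt_pos.2 (by norm_num)

/-- `(111)` layer index of a site of the coefficient model. -/
def layer (n : Site) : ℤ := n 0 + n 1 + n 2

/-- The cubic frame: positions of the three coefficient generators `e₀, e₁, e₂`
(`(1,1,0)/√2, (1,0,1)/√2, (0,1,1)/√2`). -/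
def cubicFrame : Fin 3 → E3 :=
  ![(Real.sqrt 2)⁻¹ • !₂[(1 : ℝ), 1, 0], (Real.sqrt 2)⁻¹ • !₂[(1 : ℝ), 0, 1],
    (Real.sqrt 2)⁻¹ • !₂[(0 : ℝ), 1, 1]]

/-- The reference frame for layer spacing `h`: `w + h e₃`, `w + h e₃ − u`, `w + h e₃ − v`. -/
def refFrameH (h : ℝ) : Fin 3 → E3 :=
  ![barlowOffset 1 + layerNormal h, barlowOffset 1 + layerNormal h - triangularVec₁ 1,
    barlowOffset 1 + layerNormal h - triangularVec₂ 1]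

/-- The reference frame: the three layer-`1` nearest neighbours of the origin in `fccStacking 1 h`. -/
def refFrame : Fin 3 → E3 := refFrameH hB

/-- A site is the integer combination of the cubic frame with its coefficients. -/
theorem site_eq_sum_cubicFrame (n : Site) : site n = ∑ a : Fin 3, (n a : ℝ) • cubicFrame a := by
  ext i
  fin_cases i <;> simp [site, cubicFrame, fccPoint, Fin.sum_univ_three, intVec_apply] <;> ring

/-- Gram matrix of the cubic frame: `1` on the diagonal, `½` off it. -/
theorem inner_cubicFrame (i j : Fin 3) :
    ⟪cubicFrame i, cubicFrame j⟫ = if i = j then (1 : ℝ) else 1 / 2 := by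
  have hs : (Real.sqrt 2)⁻¹ * (Real.sqrt 2)⁻¹ = 2⁻¹ := by
    rw [← mul_inv, Real.mul_self_sqrt (by norm_num)]
  fin_cases i <;> fin_cases j <;>
    simp only [PiLp.inner_apply, RCLike.inner_apply, conj_trivial, Fin.sum_univ_three] <;>
    simp [cubicFrame] <;> linarith [hs]

/-- Gram matrix of the reference frame with `h² = 2/3`: the same. -/
theorem inner_refFrameH {h : ℝ} (hh : h ^ 2 = 2 / 3) (i j : Fin 3) :
    ⟪refFrameH h i, refFrameH h j⟫ = if i = j then (1 : ℝ) else 1 / 2 := by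
  have h3 : Real.sqrt 3 ^ 2 = 3 := Real.sq_sqrt (by norm_num)
  fin_cases i <;> fin_cases j <;>
    simp only [PiLp.inner_apply, RCLike.inner_apply, conj_trivial, Fin.sum_univ_three] <;>
    simp [refFrameH, barlowOffset, layerNormal, triangularVec₁, triangularVec₂] <;>
    nlinarith [h3, hh]

/-- Gram matrix of the reference frame. -/
theorem inner_refFrame (i j : Fin 3) : ⟪refFrame i, refFrame j⟫ = if i = j then (1 : ℝ) else 1 / 2 :=
  inner_refFrameH hB_sq i j

/-- The cubic frame is linearly independent. -/
theorem linearIndependent_cubicFrame : LinearIndependent ℝ cubicFrame := by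
  rw [Fintype.linearIndependent_iff]
  intro g hg
  have hs : (0 : ℝ) < (Real.sqrt 2)⁻¹ := by positivity
  have e0 := congrArg (fun v : E3 => v 0) hg
  have e1 := congrArg (fun v : E3 => v 1) hg
  have e2 := congrArg (fun v : E3 => v 2) hg
  simp [Fin.sum_univ_three, cubicFrame] at e0 e1 e2
  have h0 : (g 0 + g 1) * (Real.sqrt 2)⁻¹ = 0 := by linarith [e0]
  have h1 : (g 0 + g 2) * (Real.sqrt 2)⁻¹ = 0 := by linarith [e1]
  have h2 : (g 1 + g 2) * (Real.sqrt 2)⁻¹ = 0 := by linarith [e2]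
  have h0' := (mul_eq_zero.1 h0).resolve_right hs.ne'
  have h1' := (mul_eq_zero.1 h1).resolve_right hs.ne'
  have h2' := (mul_eq_zero.1 h2).resolve_right hs.ne'
  intro i
  fin_cases i <;> simp <;> linarith

/-- The cubic frame as a basis of `ℝ³`. -/
def cubicBasis : Module.Basis (Fin 3) ℝ E3 :=
  basisOfLinearIndependentOfCardEqFinrank linearIndependent_cubicFrame (by simp)

/-- The basis vectors are the cubic frame. -/
theorem cubicBasis_apply (i : Fin 3) : cubicBasis i = cubicFrame i :=
  congrFun (coe_basisOfLinearIndependentOfCardEqFinrank linearIndependent_cubicFrame _) i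

/-- The linear map "match the frames". -/
def toRefLin : E3 →ₗ[ℝ] E3 := cubicBasis.constr ℝ refFrame

/-- It maps the cubic frame to the reference frame. -/
theorem toRefLin_cubicFrame (i : Fin 3) : toRefLin (cubicFrame i) = refFrame i := by
  rw [toRefLin, ← cubicBasis_apply]; exact cubicBasis.constr_basis ℝ refFrame i

/-- It preserves inner products (equal Gram matrices). -/
theorem inner_toRefLin (x y : E3) : ⟪toRefLin x, toRefLin y⟫ = ⟪x, y⟫ := by
  have key : LinearMap.BilinForm.comp (innerₗ E3) toRefLin toRefLin = innerₗ E3 := by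
    refine LinearMap.BilinForm.ext_basis cubicBasis fun i j => ?_
    rw [LinearMap.BilinForm.comp_apply, innerₗ_apply_apply, innerₗ_apply_apply, cubicBasis_apply,
      cubicBasis_apply, toRefLin_cubicFrame, toRefLin_cubicFrame, inner_refFrame, inner_cubicFrame]
  have := congrArg (fun B : LinearMap.BilinForm ℝ E3 => B x y) key
  simpa only [LinearMap.BilinForm.comp_apply, innerₗ_apply_apply] using this

/-- **The cubic-to-reference isometry** `toRef : ℝ³ ≃ₗᵢ ℝ³`. -/
def toRef : E3 ≃ₗᵢ[ℝ] E3 :=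
  (toRefLin.isometryOfInner inner_toRefLin).toLinearIsometryEquiv rfl

/-- `toRef` is `toRefLin`. -/
theorem toRef_apply (x : E3) : toRef x = toRefLin x := by
  rw [toRef, LinearIsometry.toLinearIsometryEquiv_apply]; rfl

/-- `toRef` on the cubic frame. -/
theorem toRef_cubicFrame (i : Fin 3) : toRef (cubicFrame i) = refFrame i := by
  rw [toRef_apply, toRefLin_cubicFrame]

/-- **`toRef` on sites**: `toRef (site n) = barlowPos 1 h const (n₀+n₁+n₂) (−n₁) (−n₂)`. -/
theorem toRef_site (n : Site) :
    toRef (site n) = barlowPos 1 hB constHagg (layer n) (-(n 1)) (-(n 2)) := by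
  rw [site_eq_sum_cubicFrame, map_sum]
  simp only [map_smul, toRef_cubicFrame, Fin.sum_univ_three]
  rw [barlowPos, haggLabel_const]
  simp only [refFrame, refFrameH, Matrix.cons_val_zero, Matrix.cons_val_one, Matrix.cons_val_two,
    Matrix.head_cons, Matrix.tail_cons, layer, Int.cast_add, Int.cast_neg]
  module

/-- Every reference lattice point is the image of a site. -/
theorem barlowPos_eq_toRef_site (k i j : ℤ) :
    barlowPos 1 hB constHagg k i j = toRef (site ![k + i + j, -i, -j]) := by
  rw [toRef_site]
  simp only [layer, Matrix.cons_val_zero, Matrix.cons_val_one, Matrix.cons_val_two, Matrix.head_cons,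
    Matrix.tail_cons, neg_neg]
  congr 1; ring

/-- `toRef` carries the site lattice into the reference fcc stacking. -/
theorem toRef_site_mem_fccStacking (n : Site) : toRef (site n) ∈ fccStacking 1 hB := by
  rw [toRef_site]; exact ⟨_, _, _, rfl⟩

/-- The image of the site lattice is the reference fcc stacking. -/
theorem image_toRef_range_site : toRef '' Set.range site = fccStacking 1 hB := by
  ext r
  constructor
  · rintro ⟨_, ⟨n, rfl⟩, rfl⟩; exact toRef_site_mem_fccStacking n
  · intro hr
    obtain ⟨k, i, j, rfl⟩ := mem_barlowStacking_iff.1 hr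
    exact ⟨site ![k + i + j, -i, -j], ⟨_, rfl⟩, (barlowPos_eq_toRef_site k i j).symm⟩

/-- A point of the reference stacking is the image of a site. -/
theorem exists_site_of_mem_fccStacking {r : E3} (hr : r ∈ fccStacking 1 hB) :
    ∃ n : Site, toRef (site n) = r := by
  have : r ∈ toRef '' Set.range site := by rw [image_toRef_range_site]; exact hr
  obtain ⟨_, ⟨n, rfl⟩, h⟩ := this
  exact ⟨n, h⟩

/-- Sites of layer `i` go to Barlow layer `i`. -/
theorem toRef_site_mem_barlowLayer (n : Site) :
    toRef (site n) ∈ barlowLayer 1 hB constHagg (layer n) := by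
  rw [toRef_site]; exact ⟨_, _, rfl⟩

/-- Barlow layer `i` consists of images of sites of layer `i`. -/
theorem exists_site_of_mem_barlowLayer {i : ℤ} {r : E3} (hr : r ∈ barlowLayer 1 hB constHagg i) :
    ∃ n : Site, layer n = i ∧ toRef (site n) = r := by
  obtain ⟨a, b, rfl⟩ := hr
  refine ⟨![i + a + b, -a, -b], ?_, (barlowPos_eq_toRef_site i a b).symm⟩
  simp only [layer, Matrix.cons_val_zero, Matrix.cons_val_one, Matrix.cons_val_two, Matrix.head_cons,
    Matrix.tail_cons]; ring

/-- The third coordinate of an image site is `h ×` its layer. -/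
theorem toRef_site_apply_two (n : Site) : toRef (site n) 2 = (layer n : ℝ) * hB := by
  rw [toRef_site, Literature.MathematicalPhysics.StatisticalMechanics.barlowPos_apply_two]

/-- **The height functional**: `(toRef x)₃ = (h/2) · ⟪(1,1,1), √2 x⟫`. -/
theorem toRef_apply_two (x : E3) :
    toRef x 2 = hB / 2 * ⟪intVec (normal4 0), Real.sqrt 2 • x⟫ := by
  -- both sides are linear in `x`; compare them on the cubic basis
  let L₁ : E3 →ₗ[ℝ] ℝ := (EuclideanSpace.proj (2 : Fin 3)).toLinearMap ∘ₗ toRefLin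
  let L₂ : E3 →ₗ[ℝ] ℝ := (hB / 2 * Real.sqrt 2) • (innerₛₗ ℝ (intVec (normal4 0) : E3))
  have hL : L₁ = L₂ := by
    refine cubicBasis.ext fun i => ?_
    simp only [L₁, L₂, LinearMap.coe_comp, Function.comp_apply, cubicBasis_apply, toRefLin_cubicFrame,
      ContinuousLinearMap.coe_coe, LinearMap.smul_apply, innerₛₗ_apply_apply, smul_eq_mul]
    fin_cases i <;> rw [inner_intVec_left] <;>
      simp [refFrame, refFrameH, cubicFrame, barlowOffset, layerNormal, triangularVec₁, triangularVec₂,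
        normal4] <;> field_simp <;> ring
  have := LinearMap.congr_fun hL x
  simp only [L₁, L₂, LinearMap.coe_comp, Function.comp_apply, ContinuousLinearMap.coe_coe,
    LinearMap.smul_apply, innerₛₗ_apply_apply, smul_eq_mul] at this
  rw [toRef_apply, show toRefLin x 2 = EuclideanSpace.proj (2 : Fin 3) (toRefLin x) from rfl, this,
    real_inner_smul_right]
  ring

/-- The open `(111)` bilayer slab `i` of the cubic model. -/
def cubicSlab (i : ℤ) : Set E3 :=
  {x | (2 * i : ℝ) < ⟪intVec (normal4 0), Real.sqrt 2 • x⟫ ∧ ⟪intVec (normal4 0), Real.sqrt 2 • x⟫ < 2 * i + 2}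

/-- **Slabs correspond**: `toRef '' cubicSlab i = {r | i h < r₃ < (i+1) h}`. -/
theorem image_toRef_cubicSlab (i : ℤ) :
    toRef '' cubicSlab i = {r : E3 | (i : ℝ) * hB < r 2 ∧ r 2 < ((i : ℝ) + 1) * hB} := by
  have hh := hB_pos
  ext r
  constructor
  · rintro ⟨x, ⟨h1, h2⟩, rfl⟩
    have h := toRef_apply_two x
    refine ⟨?_, ?_⟩
    · show (i : ℝ) * hB < toRef x 2
      rw [h]; nlinarith
    · show toRef x 2 < ((i : ℝ) + 1) * hB
      rw [h]; nlinarith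
  · rintro ⟨h1, h2⟩
    refine ⟨toRef.symm r, ⟨?_, ?_⟩, toRef.apply_symm_apply r⟩
    · have := toRef_apply_two (toRef.symm r)
      rw [toRef.apply_symm_apply] at this
      nlinarith
    · have := toRef_apply_two (toRef.symm r)
      rw [toRef.apply_symm_apply] at this
      nlinarith

end Summit.Ventures.Crystal3D.TentCertificate

end
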